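import Literature.Computability.Complexity.ExtMonotoneGates
import Literature.Barriers.PneNP.TSPExtensionComplexityFarkas
import Mathlib

/-!
# Helper `conv_twoRows_structure` of line `width-threshold-certificate-sparsity`
(crux `CliqueExtLowerBound`, stmt-PneNP-10682)

CONV GATES WITH AT MOST TWO CONSTRAINT ROWS ARE ANDS OF TWO THRESHOLDS: a CONV gate of width
`≤ s` with `p ≤ 2` rows (`φ(v) = 1` iff `∃ Y ⪰ 0, ∀ i, tr (Aᵢ Y) ≤ rᵢ(v)` with
`rᵢ(v) := bᵢ + ∑ⱼ Bᵢⱼ [vⱼ]`, `B ≥ 0`; the psd dimension `q` is arbitrary) accepts `v` iff at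
most `(s+1)²` (in fact two) non-negatively weighted real threshold conditions
`h_l ≤ ∑ⱼ β_{lj} [vⱼ]` (`β ≥ 0`) all hold.

Proof. The set `K := {R : ∃ Y ⪰ 0, ∀ i, tr (Aᵢ Y) ≤ Rᵢ}` of feasible right-hand sides is a
convex cone containing the non-negative orthant (`sdpFeasible_add/smul/of_nonneg`), and `v` is
accepted iff its image `r(v)` lies in `K`. `p = 0`: everything is accepted. `1 ≤ p ≤ 2`:
duplicating a row if `p = 1` we may index the rows by `Fin 2`, so `K ⊆ ℝ²`. The point is to
avoid the (possibly non-closed, non-polyhedral) cone `K` and to work with the finitely many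
images instead (`cone_two_normals`): the ACCEPTED images together with `e₀, e₁` generate a
finitely generated cone `C ⊆ K`, so a REJECTED image `x ∉ C`, and the finite Farkas lemma
(`Literature.Barriers.PneNP.farkas`) gives a normal `ν ≥ 0`, normalised to `ν₀ + ν₁ = 1`, with
`⟨g, ν⟩ ≥ 0` on all accepted images and `⟨x, ν⟩ < 0`. Among these finitely many normals take
the two extreme ones (`ν₁` minimal / maximal): every other one is a convex combination of them,
so (`dotProduct_nonneg_of_between`) each rejected image is already cut off by one of the two,
while both are `≥ 0` on every accepted image. The two normals `λˡ` give the thresholds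
`β_{lj} := ∑ₖ λˡₖ B_{kj} ≥ 0`, `h_l := -∑ₖ b_k λˡₖ` (`dotProduct_affine`).
-/

set_option linter.dupNamespace false

open Literature.Computability.Complexity Finset Matrix

noncomputable section

namespace Summit.PneNP.PneNP.Theorems.CliqueExtLowerBound.WidthThreshold.ConvTwoRows

/-! ### The feasible right-hand sides of a semidefinite system form a convex cone -/

/-- The feasibility cone `{R : ∃ Y ⪰ 0, ∀ i, tr (Aᵢ Y) ≤ Rᵢ}` is closed under addition
(add the witnesses). [folklore] -/
theorem sdpFeasible_add {p q : ℕ} (A : Fin p → Matrix (Fin q) (Fin q) ℝ) {R R' : Fin p → ℝ}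
    (hR : ∃ Y : Matrix (Fin q) (Fin q) ℝ, Y.PosSemidef ∧ ∀ i, (A i * Y).trace ≤ R i)
    (hR' : ∃ Y : Matrix (Fin q) (Fin q) ℝ, Y.PosSemidef ∧ ∀ i, (A i * Y).trace ≤ R' i) :
    ∃ Y : Matrix (Fin q) (Fin q) ℝ, Y.PosSemidef ∧ ∀ i, (A i * Y).trace ≤ (R + R') i := by
  obtain ⟨Y, hY, h⟩ := hR
  obtain ⟨Y', hY', h'⟩ := hR'
  refine ⟨Y + Y', hY.add hY', fun i => ?_⟩
  rw [Matrix.mul_add, trace_add, Pi.add_apply]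
  exact add_le_add (h i) (h' i)

/-- The feasibility cone `{R : ∃ Y ⪰ 0, ∀ i, tr (Aᵢ Y) ≤ Rᵢ}` is closed under non-negative
scaling (scale the witness). [folklore] -/
theorem sdpFeasible_smul {p q : ℕ} (A : Fin p → Matrix (Fin q) (Fin q) ℝ) {c : ℝ} (hc : 0 ≤ c)
    {R : Fin p → ℝ}
    (hR : ∃ Y : Matrix (Fin q) (Fin q) ℝ, Y.PosSemidef ∧ ∀ i, (A i * Y).trace ≤ R i) :
    ∃ Y : Matrix (Fin q) (Fin q) ℝ, Y.PosSemidef ∧ ∀ i, (A i * Y).trace ≤ (c • R) i := by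
  obtain ⟨Y, hY, h⟩ := hR
  refine ⟨c • Y, hY.smul hc, fun i => ?_⟩
  rw [Matrix.mul_smul, trace_smul, Pi.smul_apply, smul_eq_mul, smul_eq_mul]
  exact mul_le_mul_of_nonneg_left (h i) hc

/-- The feasibility cone `{R : ∃ Y ⪰ 0, ∀ i, tr (Aᵢ Y) ≤ Rᵢ}` contains the non-negative
orthant (witness `Y = 0`). [folklore] -/
theorem sdpFeasible_of_nonneg {p q : ℕ} (A : Fin p → Matrix (Fin q) (Fin q) ℝ) {R : Fin p → ℝ}
    (hR : ∀ i, 0 ≤ R i) :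
    ∃ Y : Matrix (Fin q) (Fin q) ℝ, Y.PosSemidef ∧ ∀ i, (A i * Y).trace ≤ R i :=
  ⟨0, PosSemidef.zero, fun i => by rw [Matrix.mul_zero, trace_zero]; exact hR i⟩

/-! ### Two non-negative normals decide membership of finitely many points of a plane cone -/

/-- Interpolation between normalised normals of the plane: if `a, c, ν ∈ ℝ²` all have
coordinate sum `1` and `a₁ ≤ ν₁ ≤ c₁`, then `ν` is a convex combination of `a` and `c`, so
`⟨y, a⟩ ≥ 0` and `⟨y, c⟩ ≥ 0` force `⟨y, ν⟩ ≥ 0`. [folklore] -/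
theorem dotProduct_nonneg_of_between (a c ν y : Fin 2 → ℝ) (ha : a 0 + a 1 = 1)
    (hc : c 0 + c 1 = 1) (hν : ν 0 + ν 1 = 1) (h₁ : a 1 ≤ ν 1) (h₂ : ν 1 ≤ c 1)
    (hay : 0 ≤ y ⬝ᵥ a) (hcy : 0 ≤ y ⬝ᵥ c) : 0 ≤ y ⬝ᵥ ν := by
  simp only [dotProduct, Fin.sum_univ_two] at hay hcy ⊢
  rcases eq_or_lt_of_le (h₁.trans h₂) with hac | hac
  · -- degenerate segment: `ν = a`
    have hν1 : ν 1 = a 1 := le_antisymm (hac ▸ h₂) h₁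
    have hν0 : ν 0 = a 0 := by linarith
    rw [hν0, hν1]
    exact hay
  · have ha' : a 0 = 1 - a 1 := by linarith
    have hc' : c 0 = 1 - c 1 := by linarith
    have hν' : ν 0 = 1 - ν 1 := by linarith
    have key : (c 1 - a 1) * (y 0 * ν 0 + y 1 * ν 1) =
        (c 1 - ν 1) * (y 0 * a 0 + y 1 * a 1) + (ν 1 - a 1) * (y 0 * c 0 + y 1 * c 1) := by
      rw [ha', hc', hν']
      ring
    have hprod : 0 ≤ (c 1 - a 1) * (y 0 * ν 0 + y 1 * ν 1) := by
      rw [key]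
      exact add_nonneg (mul_nonneg (sub_nonneg.2 h₂) hay) (mul_nonneg (sub_nonneg.2 h₁) hcy)
    exact (mul_nonneg_iff_of_pos_left (sub_pos.2 hac)).1 hprod

/-- **Two normals suffice in the plane.** Let `K ⊆ ℝ²` be closed under addition and
non-negative scaling and contain the non-negative quadrant, and let `x_k` (`k ∈ ι`, finite) be
points of the plane. Then there are two normals `λ⁰, λ¹ ≥ 0` such that `x_k ∈ K` iff
`⟨x_k, λ⁰⟩ ≥ 0` and `⟨x_k, λ¹⟩ ≥ 0`. Proof: the points `x_k ∈ K` together with `e₀, e₁`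
generate a cone `C ⊆ K`; a point `x_k ∉ K` is not in `C`, so Farkas' lemma for the finitely
generated cone `C` yields a normal `ν ≥ 0` (normalised to `ν₀ + ν₁ = 1`) non-negative on `C` and
negative at `x_k`; the two normals with extreme `ν₁` among these finitely many already cut off
every `x_k ∉ K` (`dotProduct_nonneg_of_between`). [folklore] -/
theorem cone_two_normals {ι : Type*} [Fintype ι] (K : Set (Fin 2 → ℝ))
    (hadd : ∀ u ∈ K, ∀ w ∈ K, u + w ∈ K) (hsmul : ∀ c : ℝ, 0 ≤ c → ∀ u ∈ K, c • u ∈ K)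
    (horth : ∀ u : Fin 2 → ℝ, (∀ i, 0 ≤ u i) → u ∈ K) (x : ι → Fin 2 → ℝ) :
    ∃ lam : Fin 2 → Fin 2 → ℝ, (∀ l i, 0 ≤ lam l i) ∧
      ∀ k, x k ∈ K ↔ ∀ l, 0 ≤ x k ⬝ᵥ lam l := by
  classical
  -- one normalised separating normal per point outside `K`
  have key : ∀ k, x k ∉ K → ∃ ν : Fin 2 → ℝ, (0 ≤ ν 0 ∧ 0 ≤ ν 1 ∧ ν 0 + ν 1 = 1) ∧
      (∀ k', x k' ∈ K → 0 ≤ x k' ⬝ᵥ ν) ∧ x k ⬝ᵥ ν < 0 := by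
    intro k hk
    -- generators: the points inside `K` (those outside replaced by `0`) and `e₀`, `e₁`
    let g : ι ⊕ Fin 2 → Fin 2 → ℝ :=
      Sum.elim (fun k' => if x k' ∈ K then x k' else 0) fun i => Pi.single i 1
    have h0 : (0 : Fin 2 → ℝ) ∈ K := horth 0 fun _ => le_rfl
    have hg : ∀ j, g j ∈ K := by
      rintro (k' | i)
      · show (if x k' ∈ K then x k' else 0) ∈ K
        split_ifs with h
        exacts [h, h0]
      · show Pi.single i (1 : ℝ) ∈ K
        refine horth _ fun i' => ?_
        rcases eq_or_ne i' i with rfl | h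
        · rw [Pi.single_eq_same]
          exact zero_le_one
        · rw [Pi.single_eq_of_ne h]
    rcases Literature.Barriers.PneNP.farkas g (x k) with ⟨μ, hμ, hx⟩ | ⟨y, hy, hxy⟩
    · -- `x k` would be a non-negative combination of elements of `K`
      refine absurd ?_ hk
      have hxk : x k = ∑ j, μ j • g j := by
        funext v
        rw [hx v, Finset.sum_apply]
        simp only [Pi.smul_apply, smul_eq_mul]
      rw [hxk]
      exact Finset.sum_induction _ (· ∈ K) (fun u w hu hw => hadd u hu w hw) h0
        fun j _ => hsmul _ (hμ j) _ (hg j)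
    · have hy0 : 0 ≤ y 0 := by simpa [g] using hy (Sum.inr 0)
      have hy1 : 0 ≤ y 1 := by simpa [g] using hy (Sum.inr 1)
      have hs : 0 < y 0 + y 1 := by
        rcases (add_nonneg hy0 hy1).lt_or_eq with h | h
        · exact h
        · exfalso
          have hy0' : y 0 = 0 := by linarith
          have hy1' : y 1 = 0 := by linarith
          have : x k ⬝ᵥ y = 0 := by simp [dotProduct, Fin.sum_univ_two, hy0', hy1']
          exact hxy.ne this
      refine ⟨(y 0 + y 1)⁻¹ • y, ⟨?_, ?_, ?_⟩, fun k' hk' => ?_, ?_⟩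
      · rw [Pi.smul_apply, smul_eq_mul]
        exact mul_nonneg (inv_nonneg.2 hs.le) hy0
      · rw [Pi.smul_apply, smul_eq_mul]
        exact mul_nonneg (inv_nonneg.2 hs.le) hy1
      · rw [Pi.smul_apply, Pi.smul_apply, smul_eq_mul, smul_eq_mul, ← mul_add,
          inv_mul_cancel₀ hs.ne']
      · rw [dotProduct_smul, smul_eq_mul]
        refine mul_nonneg (inv_nonneg.2 hs.le) ?_
        simpa [g, hk'] using hy (Sum.inl k')
      · rw [dotProduct_smul, smul_eq_mul]
        exact mul_neg_of_pos_of_neg (inv_pos.2 hs) hxy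
  choose! ν hν using key
  by_cases hRej : (univ.filter fun k => x k ∉ K).Nonempty
  · obtain ⟨klo, hklo, hlo⟩ := exists_min_image _ (fun k => ν k 1) hRej
    obtain ⟨khi, hkhi, hhi⟩ := exists_max_image _ (fun k => ν k 1) hRej
    have hklo' : x klo ∉ K := (mem_filter.1 hklo).2
    have hkhi' : x khi ∉ K := (mem_filter.1 hkhi).2
    refine ⟨![ν klo, ν khi], fun l i => ?_, fun k => ⟨fun hk l => ?_, fun h => ?_⟩⟩
    · fin_cases l <;> fin_cases i
      · simpa using (hν klo hklo').1.1
      · simpa using (hν klo hklo').1.2.1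
      · simpa using (hν khi hkhi').1.1
      · simpa using (hν khi hkhi').1.2.1
    · refine Fin.cases ?_ (fun l => ?_) l
      · simpa using (hν klo hklo').2.1 k hk
      · rw [Subsingleton.elim l 0]
        simpa using (hν khi hkhi').2.1 k hk
    · by_contra hk
      have hkR : k ∈ univ.filter fun k => x k ∉ K := mem_filter.2 ⟨mem_univ _, hk⟩
      have hl : 0 ≤ x k ⬝ᵥ ν klo := by simpa using h 0
      have hh : 0 ≤ x k ⬝ᵥ ν khi := by simpa using h 1
      exact (not_le.2 (hν k hk).2.2) (dotProduct_nonneg_of_between (ν klo) (ν khi) (ν k) (x k)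
        (hν klo hklo').1.2.2 (hν khi hkhi').1.2.2 (hν k hk).1.2.2 (hlo k hkR) (hhi k hkR) hl hh)
  · -- no point outside `K`: two vacuous conditions
    refine ⟨0, fun _ _ => le_rfl, fun k => ?_⟩
    have hk : x k ∈ K := by
      by_contra h
      exact hRej ⟨k, mem_filter.2 ⟨mem_univ _, h⟩⟩
    simp [hk]

/-! ### From normals to thresholds -/

/-- Pairing an affine image `R_k = b'_k + ∑ⱼ B'_{kj} xⱼ` with a normal `ν` gives the affine
function `∑ₖ b'_k ν_k + ∑ⱼ (∑ₖ ν_k B'_{kj}) xⱼ` of `x`. [folklore] -/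
theorem dotProduct_affine {p n : ℕ} (b' ν : Fin p → ℝ) (B' : Fin p → Fin n → ℝ)
    (x : Fin n → ℝ) :
    (fun k => b' k + ∑ j, B' k j * x j) ⬝ᵥ ν = ∑ k, b' k * ν k + ∑ j, (∑ k, ν k * B' k j) * x j := by
  simp only [dotProduct, add_mul, sum_add_distrib, sum_mul]
  congr 1
  rw [sum_comm]
  exact sum_congr rfl fun j _ => sum_congr rfl fun k _ => by ring

/-! ### The helper theorem -/

/-- HELPER `conv_twoRows_structure` of line `width-threshold-certificate-sparsity`: a CONV gate
of width `≤ s` with at most two constraint rows (`p ≤ 2`, psd dimension `q` arbitrary) computes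
an AND of at most `(s+1)²` non-negatively weighted REAL threshold functions of its inputs.
`p = 0`: the gate is constantly true (no thresholds). `1 ≤ p ≤ 2`: index the rows by `Fin 2`
(repeating the row if `p = 1`); the feasible right-hand sides form a convex cone `K ⊆ ℝ²`
containing the quadrant, the gate accepts `v` iff `r(v) ∈ K`, and `cone_two_normals` produces
two normals `λ⁰, λ¹ ≥ 0` deciding membership of the finitely many images `r(v)`; each
`⟨r(v), λˡ⟩ ≥ 0` is the threshold `-∑ₖ b_k λˡ_k ≤ ∑ⱼ (∑ₖ λˡ_k B_{kj}) [vⱼ]`. [folklore] -/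
theorem conv_twoRows_structure : ∀ (s : ℕ) (φ : GateFn),
    (∃ p q : ℕ, p + q ≤ s ∧ p ≤ 2 ∧ ∃ (A : Fin p → Matrix (Fin q) (Fin q) ℝ) (b : Fin p → ℝ)
      (B : Fin p → Fin φ.1 → ℝ), (∀ i j, 0 ≤ B i j) ∧ ∀ v : Fin φ.1 → Bool, φ.2 v = true ↔
        ∃ Y : Matrix (Fin q) (Fin q) ℝ, Y.PosSemidef ∧
          ∀ i, (A i * Y).trace ≤ b i + ∑ j, B i j * (if v j then (1 : ℝ) else 0)) →
    ∃ (K : ℕ) (β : Fin K → Fin φ.1 → ℝ) (h : Fin K → ℝ), K ≤ (s + 1) ^ 2 ∧ (∀ l j, 0 ≤ β l j) ∧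
      ∀ v : Fin φ.1 → Bool, φ.2 v = true ↔ ∀ l, h l ≤ ∑ j, β l j * (if v j then (1 : ℝ) else 0) := by
  rintro s φ ⟨p, q, hpq, hp2, A, b, B, hB, hφ⟩
  rcases Nat.eq_zero_or_pos p with rfl | hp
  · -- no rows: the gate is constantly true
    refine ⟨0, fun l => l.elim0, fun l => l.elim0, Nat.zero_le _, fun l => l.elim0, fun v => ?_⟩
    rw [hφ v]
    exact iff_of_true ⟨0, PosSemidef.zero, fun i => i.elim0⟩ fun l => l.elim0
  · -- `1 ≤ p ≤ 2`: index the rows (with repetition) by `Fin 2`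
    let f : Fin 2 → Fin p := fun k => ⟨min k.1 (p - 1), by omega⟩
    have hf : ∀ C : Fin p → Prop, (∀ i, C i) ↔ ∀ k, C (f k) := fun C =>
      ⟨fun h k => h _, fun h i => by
        have hi2 : i.1 < 2 := lt_of_lt_of_le i.2 hp2
        have hi : f ⟨i.1, hi2⟩ = i := Fin.ext (by show min i.1 (p - 1) = i.1; omega)
        exact hi ▸ h _⟩
    -- the images `r(v) ∈ ℝ²` and the feasibility cone `K ⊆ ℝ²`
    let x : (Fin φ.1 → Bool) → Fin 2 → ℝ := fun v k =>
      b (f k) + ∑ j, B (f k) j * (if v j then (1 : ℝ) else 0)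
    let K : Set (Fin 2 → ℝ) :=
      {R | ∃ Y : Matrix (Fin q) (Fin q) ℝ, Y.PosSemidef ∧ ∀ k, (A (f k) * Y).trace ≤ R k}
    have hφ' : ∀ v, φ.2 v = true ↔ x v ∈ K := fun v => by
      rw [hφ v]
      exact exists_congr fun Y => and_congr Iff.rfl
        (hf fun i => (A i * Y).trace ≤ b i + ∑ j, B i j * (if v j then (1 : ℝ) else 0))
    obtain ⟨lam, hlam, hiff⟩ := cone_two_normals K
      (fun u hu w hw => sdpFeasible_add (fun k => A (f k)) hu hw)
      (fun c hc u hu => sdpFeasible_smul (fun k => A (f k)) hc hu)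
      (fun u hu => sdpFeasible_of_nonneg (fun k => A (f k)) hu) x
    refine ⟨2, fun l j => ∑ k, lam l k * B (f k) j, fun l => -∑ k, b (f k) * lam l k, ?_,
      fun l j => sum_nonneg fun k _ => mul_nonneg (hlam l k) (hB _ _), fun v => ?_⟩
    · calc 2 ≤ s + 1 := by omega
        _ ≤ (s + 1) ^ 2 := Nat.le_self_pow two_ne_zero _
    · rw [hφ' v, hiff v]
      refine forall_congr' fun l => ?_
      have hx : x v ⬝ᵥ lam l = ∑ k, b (f k) * lam l k +
          ∑ j, (∑ k, lam l k * B (f k) j) * (if v j then (1 : ℝ) else 0) :=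
        dotProduct_affine (fun k => b (f k)) (lam l) (fun k => B (f k)) _
      rw [hx]
      constructor <;> intro h <;> linarith

end Summit.PneNP.PneNP.Theorems.CliqueExtLowerBound.WidthThreshold.ConvTwoRows
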